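import Summits.MatrixMultiplication.MatrixMultiplication.Theorems.ObstructionDescentHullDesignTop

/- `set_option linter.dupNamespace false` as in the sibling kernel files (namespace `…Theorems.<FileStem>`). -/
set_option linter.dupNamespace false

/-!
# The leaf `E` on the boundary cells: one linear-span membership per `n` (decomp-mm · lens 3 · gen 25, part 3)

Route `route-MatrixMultiplication-ObstructionDescent` (`ω(ℂ) = 2`), leaf `E = NoPolyDegreeObstruction` (item 30889).  `E` quantifies over all
cells `(n, m)` with `n² ≤ m`, `n^τ ≤ m` and asks `⟨n,n,n⟩ ∈ Hull_{m^c}(σ_m)`.  The cell family collapses onto its BOUNDARY `m₀(n) = ⌈n^τ⌉`: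
above `m ≥ n³ ≥ R(⟨n,n,n⟩)` the membership is free, and for `m₀ ≤ m < n³` one has `m^c < n^{3c} ≤ (n²)^{2c} ≤ m₀^{2c}`, so row `2c` at the
boundary cell gives row `c` at every cell (`Hull` is monotone in `m` and antitone in the degree; `transfer_of_boundary`).  Hence

* `noPolyDegreeObstruction_iff_boundary : E ⟺ ∀ c, ∀ τ > 2, ∀ᶠ n, ⟨n,n,n⟩ ∈ Hull_{m₀^c}(σ_{m₀}), m₀ = ⌈n^τ⌉₊`;
* `noPolyDegreeObstruction_iff_boundary_nat : E ⟺ ∀ c k : ℕ, ∀ᶠ n, ⟨n,n,n⟩ ∈ Hull_{m₀^c}(σ_{m₀}), m₀ = ⌈n^{2+1/(k+1)}⌉₊` (no real quantifier left);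
* with part 2 (`mem_hull_iff_exists_top_design`), THE NORMAL FORM OF THE LEAF (`noPolyDegreeObstruction_iff_boundary_top_design`):

      `E ⟺ ∀ c k : ℕ, for all large n:  ⟨n,n,n⟩^{⊠N} = ∑_{u ∈ S} w_u · u^{⊠N}`  for some finite `S ⊂ {u ∈ (ℂ^{n×n})^{⊗3} | rank u ≤ m}`, `w : S → ℂ`,
      where `m = ⌈n^{2 + 1/(k+1)}⌉` and `N = m^c`

  — a doubly-indexed SEQUENCE of single linear-algebra memberships `⟨n,n,n⟩^{⊠N} ∈ span_ℂ {u^{⊠N} | rank u ≤ m}`.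

Bookkeeping over parts 1–2 and `tensorRank_matMulTensor_le`; nothing here concerns `ω`; sorry-free; standard axioms only.
[cite: LandsbergGCT2017, §3.1.2 (p. 57), §8.3.2 (p. 226); Blaser2013, §5]
-/

set_option autoImplicit false

noncomputable section

open scoped BigOperators

namespace Summit.MatrixMultiplication.MatrixMultiplication.Theorems.ObstructionDescentHullDesignCells

open Literature.Computability.AlgebraicComplexity (tensorRank kroneckerPow matMulTensor tensorRank_matMulTensor_le)
open Summit.MatrixMultiplication.MatrixMultiplication.Theorems.ObstructionDescentHullCalculus (hull mem_hull_of_tensorRank_le hull_mono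
  hull_antitone)
open Summit.MatrixMultiplication.MatrixMultiplication.Theorems.ObstructionDescentHullDescent (noPolyDegreeObstruction_iff_hull)
open Summit.MatrixMultiplication.MatrixMultiplication.Theses.ObstructionDescent (NoPolyDegreeObstruction)
open Summit.MatrixMultiplication.MatrixMultiplication.Theorems.ObstructionDescentHullDesignTop (mem_hull_iff_exists_top_design)

/-! ## §1 Cell arithmetic -/

section Cells

/-- For `n ≥ 1` and `τ ≥ 2`: `n² ≤ ⌈n^τ⌉`. [bookkeeping] -/
theorem sq_le_ceil_rpow {n : ℕ} (hn : 1 ≤ n) {τ : ℝ} (hτ : 2 ≤ τ) : n * n ≤ ⌈(n : ℝ) ^ τ⌉₊ := by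
  have h1 : (1 : ℝ) ≤ (n : ℝ) := by exact_mod_cast hn
  have h : ((n * n : ℕ) : ℝ) ≤ (⌈(n : ℝ) ^ τ⌉₊ : ℝ) := by
    push_cast
    calc (n : ℝ) * n = (n : ℝ) ^ (2 : ℝ) := by rw [Real.rpow_two, sq]
      _ ≤ (n : ℝ) ^ τ := Real.rpow_le_rpow_of_exponent_le h1 hτ
      _ ≤ (⌈(n : ℝ) ^ τ⌉₊ : ℝ) := Nat.le_ceil _
  exact_mod_cast h

/-- Matrix multiplication lies in every hull past its rank: `m ≥ n³ ⟹ ⟨n,n,n⟩ ∈ Hull_D(σ_m)`. [bookkeeping] -/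
theorem matMulTensor_mem_hull_of_cube_le {n m : ℕ} (h : n * n * n ≤ m) (D : ℕ) :
    (fun a b c => matMulTensor ℂ n n n a b c) ∈ hull (Fin n × Fin n) (Fin n × Fin n) (Fin n × Fin n) m D :=
  mem_hull_of_tensorRank_le ((tensorRank_matMulTensor_le ℂ n n n).trans h)

/-- **Transfer from the boundary cell.**  If `n² ≤ m₀ ≤ m` and `⟨n,n,n⟩ ∈ Hull_{m₀^{2c}}(σ_{m₀})`, then `⟨n,n,n⟩ ∈ Hull_{m^c}(σ_m)`
(free for `m ≥ n³`; otherwise `m^c ≤ (n³)^c ≤ (n²)^{2c} ≤ m₀^{2c}` and `Hull` is monotone in `m`, antitone in the degree). [bookkeeping] -/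
theorem transfer_of_boundary {n m₀ m : ℕ} (c : ℕ) (hsq : n * n ≤ m₀) (hm : m₀ ≤ m)
    (h : (fun a b c => matMulTensor ℂ n n n a b c) ∈ hull (Fin n × Fin n) (Fin n × Fin n) (Fin n × Fin n) m₀ (m₀ ^ (2 * c))) :
    (fun a b c => matMulTensor ℂ n n n a b c) ∈ hull (Fin n × Fin n) (Fin n × Fin n) (Fin n × Fin n) m (m ^ c) := by
  by_cases hcube : n * n * n ≤ m
  · exact matMulTensor_mem_hull_of_cube_le hcube _
  · have hlt : m ≤ n * n * n := (Nat.lt_of_not_le hcube).le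
    have hdeg : m ^ c ≤ m₀ ^ (2 * c) :=
      calc m ^ c ≤ (n * n * n) ^ c := Nat.pow_le_pow_left hlt c
        _ ≤ (n * n * (n * n)) ^ c := Nat.pow_le_pow_left (Nat.mul_le_mul_left _ (Nat.le_mul_self n)) c
        _ = (n * n) ^ (2 * c) := by rw [pow_mul, sq]
        _ ≤ m₀ ^ (2 * c) := Nat.pow_le_pow_left hsq _
    exact hull_mono hm (hull_antitone hdeg h)

end Cells

/-! ## §2 `E` on the boundary cells -/

section Boundary

/-- **Boundary form.**  `E ⟺ ∀ c, ∀ τ > 2`, for all large `n`: `⟨n,n,n⟩ ∈ Hull_{m₀^c}(σ_{m₀})` with `m₀ = ⌈n^τ⌉`.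
[route E = NoPolyDegreeObstruction, boundary form] -/
theorem noPolyDegreeObstruction_iff_boundary : NoPolyDegreeObstruction ↔
    ∀ c : ℕ, ∀ τ : ℝ, 2 < τ → ∃ n₀ : ℕ, ∀ n : ℕ, n₀ ≤ n →
      (fun a b c => matMulTensor ℂ n n n a b c) ∈
        hull (Fin n × Fin n) (Fin n × Fin n) (Fin n × Fin n) ⌈(n : ℝ) ^ τ⌉₊ (⌈(n : ℝ) ^ τ⌉₊ ^ c) := by
  rw [noPolyDegreeObstruction_iff_hull]
  constructor
  · intro h c τ hτ
    obtain ⟨n₀, hn₀⟩ := h c τ hτ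
    refine ⟨max n₀ 1, fun n hn => hn₀ n _ (le_of_max_le_left hn) (sq_le_ceil_rpow (le_of_max_le_right hn) hτ.le) (Nat.le_ceil _)⟩
  · intro h c τ hτ
    obtain ⟨n₀, hn₀⟩ := h (2 * c) τ hτ
    refine ⟨max n₀ 1, fun n m hn _ hτm => ?_⟩
    exact transfer_of_boundary c (sq_le_ceil_rpow (le_of_max_le_right hn) hτ.le) (Nat.ceil_le.2 hτm)
      (hn₀ n (le_of_max_le_left hn))

/-- **Boundary form without reals in the quantifier prefix**: `E ⟺ ∀ c k : ℕ`, for all large `n`: `⟨n,n,n⟩ ∈ Hull_{m₀^c}(σ_{m₀})` with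
`m₀ = ⌈n^{2 + 1/(k+1)}⌉`. [route E = NoPolyDegreeObstruction, boundary form] -/
theorem noPolyDegreeObstruction_iff_boundary_nat : NoPolyDegreeObstruction ↔
    ∀ c k : ℕ, ∃ n₀ : ℕ, ∀ n : ℕ, n₀ ≤ n →
      (fun a b c => matMulTensor ℂ n n n a b c) ∈
        hull (Fin n × Fin n) (Fin n × Fin n) (Fin n × Fin n) ⌈(n : ℝ) ^ ((2 : ℝ) + 1 / ((k : ℝ) + 1))⌉₊
          (⌈(n : ℝ) ^ ((2 : ℝ) + 1 / ((k : ℝ) + 1))⌉₊ ^ c) := by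
  rw [noPolyDegreeObstruction_iff_boundary]
  constructor
  · intro h c k
    have h0 : (0 : ℝ) < 1 / ((k : ℝ) + 1) := by positivity
    exact h c _ (by linarith)
  · intro h c τ hτ
    obtain ⟨k, hk⟩ := exists_nat_one_div_lt (show (0 : ℝ) < τ - 2 by linarith)
    obtain ⟨n₀, hn₀⟩ := h (2 * c) k
    refine ⟨max n₀ 1, fun n hn => ?_⟩
    have hn1 : 1 ≤ n := le_of_max_le_right hn
    have h1 : (1 : ℝ) ≤ (n : ℝ) := by exact_mod_cast hn1
    have hτ' : (2 : ℝ) ≤ (2 : ℝ) + 1 / ((k : ℝ) + 1) := by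
      have : (0 : ℝ) < 1 / ((k : ℝ) + 1) := by positivity
      linarith
    have hmono : ⌈(n : ℝ) ^ ((2 : ℝ) + 1 / ((k : ℝ) + 1))⌉₊ ≤ ⌈(n : ℝ) ^ τ⌉₊ :=
      Nat.ceil_mono (Real.rpow_le_rpow_of_exponent_le h1 (by linarith))
    exact transfer_of_boundary c (sq_le_ceil_rpow hn1 hτ') hmono (hn₀ n (le_of_max_le_left hn))

/-- **Normal form of the leaf.**  `E ⟺ ∀ c k : ℕ`, for all large `n`, with `m = ⌈n^{2+1/(k+1)}⌉` and `N = m^c`: there are finitely many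
corner tensors `u ∈ S` of rank `≤ m` and weights `w` with `⟨n,n,n⟩^{⊠N} = ∑_{u ∈ S} w_u · u^{⊠N}` — equivalently
`⟨n,n,n⟩^{⊠N} ∈ span_ℂ {u^{⊠N} | rank u ≤ m}`: a doubly-indexed sequence of single linear-algebra memberships.
[route E = NoPolyDegreeObstruction, normal form] -/
theorem noPolyDegreeObstruction_iff_boundary_top_design : NoPolyDegreeObstruction ↔
    ∀ c k : ℕ, ∃ n₀ : ℕ, ∀ n : ℕ, n₀ ≤ n →
      ∃ S : Finset (Fin n × Fin n → Fin n × Fin n → Fin n × Fin n → ℂ),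
        (∀ u ∈ S, tensorRank u ≤ ⌈(n : ℝ) ^ ((2 : ℝ) + 1 / ((k : ℝ) + 1))⌉₊) ∧
        ∃ w : ↥S → ℂ,
          kroneckerPow (fun a b c => matMulTensor ℂ n n n a b c) (⌈(n : ℝ) ^ ((2 : ℝ) + 1 / ((k : ℝ) + 1))⌉₊ ^ c) =
            ∑ u : ↥S, w u • kroneckerPow (u : Fin n × Fin n → Fin n × Fin n → Fin n × Fin n → ℂ)
              (⌈(n : ℝ) ^ ((2 : ℝ) + 1 / ((k : ℝ) + 1))⌉₊ ^ c) := by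
  rw [noPolyDegreeObstruction_iff_boundary_nat]
  refine forall_congr' fun c => forall_congr' fun k => exists_congr fun n₀ => forall_congr' fun n => forall_congr' fun _ => ?_
  exact mem_hull_iff_exists_top_design _

end Boundary

end Summit.MatrixMultiplication.MatrixMultiplication.Theorems.ObstructionDescentHullDesignCells

end
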